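import Summits.BirchSwinnertonDyer.BirchSwinnertonDyer.Theorems.GoldfeldAllTwistsTwoConverseTwinQuarterTraceChiDescent
import Summits.BirchSwinnertonDyer.BirchSwinnertonDyer.Theorems.GoldfeldAllTwistsTwoConverseTwinQuarterTraceGalois
import HarnessLib

set_option linter.dupNamespace false -- namespace `…BirchSwinnertonDyer.BirchSwinnertonDyer…` is the cell's (D-0017 nested layout)
set_option autoImplicit false

/-!
# LINE C3⁺ (PHASE 2), file P2-T: TRANSPORT — the genus tower `J = K(√−q)(√p) ⊂ K[1]`, the subgroup `B = X₀(49)(J) ⊂ X₀(49)(ℂ)`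
# (`B[4] = {O, T}`, odd multiples of torsion in `{O, T}`), and the two membership lemmas the assembly of THEOREM A⁗ uses

Cell `bsd-goldfeld`, seat `bsd-goldfeld-s1p-c3x` (gen 7); planner ORDER (ccxxix)/(ccxxxi) «LINE C3⁺», assembly infrastructure (memo §5′
P2g). `--supports stmt-BirchSwinnertonDyer-20044` as a HELPER. Theses-free; theorems only; FACT-FREE; no definition, no `sorry`.

WHY. The quarter-trace bookkeeping compares Heegner points of TWO Hilbert class fields — `K[1]` (`K = ℚ(√−2qp)`) and `ℚ(√−qp)[1]` — which
are both subfields of `ℂ`; the comparison is made in `X₀(49)(ℂ)`, on whose subgroup `B = X₀(49)(J)`, `J = K(√−q, √p) = ℚ(√2, √−q, √p)` (the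
genus field of `K`, where `±7` are not squares: P2f), the torsion hypotheses of the core P2a′ hold.
* §1 the tower `K ⊂ K₁ = K⟮r_q⟯ ⊂ J = K₁⟮r_p⟯ ⊂ L` and `¬IsSquare (±7 : J)` (P2f's `not_isSquare_seven_genusTower_negEightTwoPrimes` with its
  six tower hypotheses discharged); the TWO-STEP DESCENT: a point of `X₀(49)(L)` fixed by every `σ ∈ Gal(L/K)` with `σ r_q = r_q`, `σ r_p = r_p`
  comes from `X₀(49)(J)` (seat c3's `exists_map_adjoin_eq_of_forall_fixing` over the base `K₁`, `Gal(L/K₁) ⊂ Gal(L/K)`).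
* §2 `B := range (X₀(49)(J) → X₀(49)(ℂ))` for any embedding `e_J : J → ℂ`: `4x = 0 ⇒ x ∈ {O, T}` on `B` (P2f `cm7_mem_pair_of_four_zsmul_eq_zero`)
  and every torsion `u ∈ B` has an ODD multiple in `{O, T}` (A″ `cm7_exists_odd_nsmul_mem_pair_of_mem_range`).
* §3 membership: (L-side) genus-fixed points of `X₀(49)(K[1])` land in `B`; (partner side) points of `X₀(49)(E)` for ANY field `E` embedded in
  `ℂ` inside the range of `e_J` land in `B` (`RingHom.rangeRestrictFieldEquiv`), together with the adjunction criterion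
  `F⟮r⟯ → ℂ ⊆ range e_J ⟸ F → ℂ ⊆ range e_J ∧ r ∈ range e_J`.
HONEST FRAMING: field/point transport only; no `L`-value; no case of K12₂″ / twin″ decided; BSD is not proved by any of this.

References: [SilvermanTate2015] §3.5; [Cox2013] §6.A Thm. 6.1; [Gross1984] §4. -/

noncomputable section

open scoped Classical IntermediateField

open WeierstrassCurve Literature.NumberTheory.EllipticCurves Literature.NumberTheory.EllipticCurves.ModularForms

namespace Summit.BirchSwinnertonDyer.BirchSwinnertonDyer.Theorems.GoldfeldGoodTwists

/-! ## §1 The genus tower inside `L` and the two-step descent -/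

section Tower

variable {K : Type} [Field K] [NumberField K] {L : Type} [Field L] [CharZero L] [Algebra K L]
  [FiniteDimensional K L] [IsGalois K L]

/-- **Two-step descent.** A point of `X₀(49)(L)` fixed by every `σ ∈ Gal(L/K)` with `σ r_q = r_q` and `σ r_p = r_p` is the image of a point
of `X₀(49)(J)`, `J = K⟮r_q⟯⟮r_p⟯` (descent over the base `K₁ = K⟮r_q⟯`: every `σ ∈ Gal(L/K₁)` fixes `r_q`). [cite: Gross1984, §4] -/
theorem exists_map_genusTower_eq_of_forall_fixing (rq rp : L) {P : (cm7.baseChange L).toAffine.Point}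
    (hP : ∀ σ : L ≃ₐ[K] L, σ rq = rq → σ rp = rp → Affine.Point.map (σ : L →ₐ[K] L) P = P) :
    ∃ z : (cm7.baseChange (K⟮rq⟯⟮rp⟯ : IntermediateField K⟮rq⟯ L)).toAffine.Point,
      Affine.Point.map (algebraMap (K⟮rq⟯⟮rp⟯ : IntermediateField K⟮rq⟯ L) L).toRatAlgHom z = P := by
  refine exists_map_adjoin_eq_of_forall_fixing cm7 (k := K⟮rq⟯) rp (fun σ hσ ↦ ?_)
  have h1 : (σ.restrictScalars K) rq = rq := by
    have h := σ.commutes (⟨rq, IntermediateField.mem_adjoin_simple_self K rq⟩ : K⟮rq⟯)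
    simpa using h
  have h2 : (σ.restrictScalars K) rp = rp := hσ
  have h := hP (σ.restrictScalars K) h1 h2
  have e : Affine.Point.map ((σ.restrictScalars K : L ≃ₐ[K] L) : L →ₐ[K] L) P =
      Affine.Point.map (σ : L →ₐ[K⟮rq⟯] L) P := by
    cases P <;> rfl
  rwa [e] at h

omit [CharZero L] [IsGalois K L] in
/-- **`−7` and `7` are not squares in `J = K⟮r_q⟯⟮r_p⟯`** (`d_K = −8qp`, `r_q² = −q`, `r_p² = p`): P2f's tower lemma with its six
tower hypotheses discharged (`[K₁ : K] = [J : K₁] = 2`, the generators are square roots off the base). [cite: SilvermanTate2015, §3.5] -/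
theorem not_isSquare_seven_genusTower (hK : IsImaginaryQuadratic K) {q p : ℕ} (hq : q.Prime) (hp : p.Prime) (hq7 : q ≠ 7)
    (hp7 : p ≠ 7) (hp2 : p ≠ 2) (hdK : NumberField.discr K = -(8 * (q : ℤ) * p)) {rq rp : L}
    (hrq : rq ^ 2 = algebraMap K L (-(q : K))) (hrp : rp ^ 2 = algebraMap K L (p : K)) :
    ¬ IsSquare (-7 : (K⟮rq⟯⟮rp⟯ : IntermediateField K⟮rq⟯ L)) ∧ ¬ IsSquare (7 : (K⟮rq⟯⟮rp⟯ : IntermediateField K⟮rq⟯ L)) := by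
  -- step one: `K₁ = K⟮rq⟯`
  have hrq' : rq ^ 2 = algebraMap K L (algebraMap ℚ K (-(q : ℚ))) := by rw [hrq]; congr 1; rw [map_neg, map_natCast]
  have ha : ¬ IsSquare (algebraMap ℚ K (-(q : ℚ))) := not_isSquare_neg_q_of_discr_negEightTwoPrimes hK hq hp hp2 hdK
  have h₁ : Module.finrank K K⟮rq⟯ = 2 := finrank_adjoin_sqrt_eq_two (L := L) hrq' ha
  have hθ₁ := gen_sq_of_sq_eq (K := K) hrq'
  have hθ₁K : ∀ a : K, algebraMap K K⟮rq⟯ a ≠ (⟨rq, IntermediateField.mem_adjoin_simple_self K rq⟩ : K⟮rq⟯) :=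
    fun a ha' ↦ gen_not_mem_range_of_not_isSquare ha hrq' ⟨a, ha'⟩
  -- step two: `J = K₁⟮rp⟯`
  have hb : ¬ IsSquare (algebraMap K K⟮rq⟯ (algebraMap ℚ K (p : ℚ))) := not_isSquare_p_quadraticStep hK hq hp hdK h₁ hθ₁ hθ₁K
  have hrp' : rp ^ 2 = algebraMap K⟮rq⟯ L (algebraMap K K⟮rq⟯ (algebraMap ℚ K (p : ℚ))) := by
    rw [hrp, map_natCast, map_natCast, map_natCast, map_natCast]
  have h₂ : Module.finrank K⟮rq⟯ (K⟮rq⟯⟮rp⟯ : IntermediateField K⟮rq⟯ L) = 2 := finrank_adjoin_sqrt_eq_two (L := L) hrp' hb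
  have hθ₂ := gen_sq_of_sq_eq (K := K⟮rq⟯) hrp'
  have hθ₂K : ∀ a : K⟮rq⟯, algebraMap K⟮rq⟯ (K⟮rq⟯⟮rp⟯ : IntermediateField K⟮rq⟯ L) a ≠
      (⟨rp, IntermediateField.mem_adjoin_simple_self K⟮rq⟯ rp⟩ : (K⟮rq⟯⟮rp⟯ : IntermediateField K⟮rq⟯ L)) :=
    fun a ha' ↦ gen_not_mem_range_of_not_isSquare hb hrp' ⟨a, ha'⟩
  exact not_isSquare_seven_genusTower_negEightTwoPrimes hK hq hp hq7 hp7 hdK h₁ hθ₁ hθ₁K h₂ hθ₂ hθ₂K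

end Tower

/-! ## §2 The subgroup `B = X₀(49)(J) ⊂ X₀(49)(M)` along an embedding `J → M`: torsion control -/

section Subgroup

variable {F : Type*} [Field F] [CharZero F] {M : Type*} [Field M] [CharZero M]

-- the point-group world of A″'s `…SevenModEightCore` / P2f (`Classical`), file-local
attribute [local instance 2000] Classical.propDecidable

/-- **`B[4] = {O, T}`**: on the range of `X₀(49)(F) → X₀(49)(M)` (`F` without `√−7`, `√7`), `4x = O ⇒ x ∈ {O, T}`. [cite: SilvermanTate2015, §3.5] -/
theorem four_zsmul_eq_zero_mem_pair_of_mem_range (f : F →+* M) (h7 : ¬ IsSquare (-7 : F)) (h7' : ¬ IsSquare (7 : F)) :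
    ∀ x ∈ (Affine.Point.map (W' := cm7) f.toRatAlgHom).range, (4 : ℤ) • x = 0 →
      x = 0 ∨ x = Affine.Point.some 2 (-1) (nonsingular_cm7_baseChange_two_neg_one M) := by
  rintro x ⟨z, rfl⟩ h4
  have hz : (4 : ℤ) • z = 0 := by
    apply Affine.Point.map_injective (W' := cm7) (f := f.toRatAlgHom)
    rw [map_zsmul, h4, map_zero]
  rcases cm7_mem_pair_of_four_zsmul_eq_zero h7 h7' hz with h | h
  · exact Or.inl (by rw [h, map_zero])
  · exact Or.inr (by rw [h, map_cm7_twoTorsion])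

/-- **Odd multiples of torsion in `{O, T}`** on the same range (A″'s `cm7_exists_odd_nsmul_mem_pair_of_mem_range`, `ℤ`-scalar form).
[cite: SilvermanTate2015, §3.5] -/
theorem exists_odd_zsmul_mem_pair_of_mem_range (f : F →+* M) (h7 : ¬ IsSquare (-7 : F)) (h7' : ¬ IsSquare (7 : F)) :
    ∀ u ∈ (Affine.Point.map (W' := cm7) f.toRatAlgHom).range, IsOfFinAddOrder u →
      ∃ n : ℤ, Odd n ∧ (n • u = 0 ∨ n • u = Affine.Point.some 2 (-1) (nonsingular_cm7_baseChange_two_neg_one M)) := by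
  intro u hu ht
  obtain ⟨n, hn, h⟩ := cm7_exists_odd_nsmul_mem_pair_of_mem_range f h7 h7' u hu ht
  refine ⟨n, by exact_mod_cast hn, ?_⟩
  rw [natCast_zsmul]
  exact h

/-- **Membership from an embedded partner field.** If `e : E → M` lands inside the range of `f : F → M`, every point of `X₀(49)(E)` maps
into `B = range (X₀(49)(F) → X₀(49)(M))` (factor `e` through `F` by `RingHom.rangeRestrictFieldEquiv`). [folklore] -/
theorem map_mem_range_of_fieldRange_le {E : Type*} [Field E] [CharZero E] (f : F →+* M) (e : E →+* M)
    (hle : e.fieldRange ≤ f.fieldRange) (z : (cm7.baseChange E).toAffine.Point) :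
    Affine.Point.map (W' := cm7) e.toRatAlgHom z ∈ (Affine.Point.map (W' := cm7) f.toRatAlgHom).range := by
  set g : E →+* F := f.rangeRestrictFieldEquiv.symm.toRingHom.comp ((Subfield.inclusion hle).comp e.rangeRestrictField) with hg
  have hfg : f.toRatAlgHom.comp g.toRatAlgHom = e.toRatAlgHom := by
    apply AlgHom.ext
    intro x
    show f (f.rangeRestrictFieldEquiv.symm (Subfield.inclusion hle (e.rangeRestrictField x))) = e x
    rw [RingHom.rangeRestrictFieldEquiv_apply_symm_apply]
    rfl
  refine ⟨Affine.Point.map (W' := cm7) g.toRatAlgHom z, ?_⟩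
  rw [Affine.Point.map_map, hfg]

omit [CharZero M] in
/-- **Adjunction criterion for the range inclusion**: if `E → M` maps the base field `F₀` and the generator `r` into a subfield `S ≤ M`, it maps
all of `F₀⟮r⟯` into `S`. [folklore] -/
theorem algebraMap_adjoin_mem_of_mem {F₀ : Type*} [Field F₀] {E : Type*} [Field E] [Algebra F₀ E] (eM : E →+* M) (S : Subfield M)
    (hF₀ : ∀ x : F₀, eM (algebraMap F₀ E x) ∈ S) {r : E} (hr : eM r ∈ S) (x : F₀⟮r⟯) : eM (algebraMap F₀⟮r⟯ E x) ∈ S := by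
  set T : IntermediateField F₀ E := (S.comap eM).toIntermediateField (fun y ↦ by exact hF₀ y) with hT
  have hle : F₀⟮r⟯ ≤ T := IntermediateField.adjoin_simple_le_iff.mpr (by exact hr)
  exact hle x.2

end Subgroup

/-! ## §3 The `L`-side membership: genus-fixed points of `X₀(49)(K[1])` lie in `B` -/

section Membership

variable {K : Type} [Field K] [NumberField K] {L : Type} [Field L] [CharZero L] [Algebra K L]
  [FiniteDimensional K L] [IsGalois K L] {M : Type*} [Field M] [CharZero M]

/-- **Genus-fixed points land in `B`.** For any embedding `eL : L → M` and `e_J := eL ∘ (J → L)`: a point of `X₀(49)(L)` fixed by every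
`σ ∈ Gal(L/K)` with `σ r_q = r_q`, `σ r_p = r_p` maps into `range (X₀(49)(J) → X₀(49)(M))`. [cite: Gross1984, §4] -/
theorem map_mem_range_genusTower_of_forall_fixing (eL : L →+* M) (rq rp : L) {P : (cm7.baseChange L).toAffine.Point}
    (hP : ∀ σ : L ≃ₐ[K] L, σ rq = rq → σ rp = rp → Affine.Point.map (σ : L →ₐ[K] L) P = P) :
    Affine.Point.map (W' := cm7) eL.toRatAlgHom P ∈
      (Affine.Point.map (W' := cm7) (eL.comp (algebraMap (K⟮rq⟯⟮rp⟯ : IntermediateField K⟮rq⟯ L) L)).toRatAlgHom).range := by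
  obtain ⟨z, hz⟩ := exists_map_genusTower_eq_of_forall_fixing rq rp hP
  refine ⟨z, ?_⟩
  have hcomp : (eL.comp (algebraMap (K⟮rq⟯⟮rp⟯ : IntermediateField K⟮rq⟯ L) L)).toRatAlgHom =
      eL.toRatAlgHom.comp (algebraMap (K⟮rq⟯⟮rp⟯ : IntermediateField K⟮rq⟯ L) L).toRatAlgHom := AlgHom.ext fun _ ↦ rfl
  rw [hcomp, ← Affine.Point.map_map, hz]

omit [IsGalois K L] in
/-- A Galois sum `Σ_σ ε(σ)•σy` with a weight invariant under left multiplication by `τ` is fixed by `τ` (c3's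
`map_sum_smul_map_eq_of_invariant`, restated for the joint genus weights used here). [folklore] -/
theorem map_sum_smul_map_eq_of_mul_invariant (τ : L ≃ₐ[K] L) (ε : (L ≃ₐ[K] L) → ℤ)
    (hε : ∀ σ, ε (τ * σ) = ε σ) (y : (cm7.baseChange L).toAffine.Point) :
    Affine.Point.map (τ : L →ₐ[K] L) (∑ σ : L ≃ₐ[K] L, ε σ • Affine.Point.map (σ : L →ₐ[K] L) y) =
      ∑ σ : L ≃ₐ[K] L, ε σ • Affine.Point.map (σ : L →ₐ[K] L) y :=
  map_sum_smul_map_eq_of_invariant cm7 τ ε hε y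

omit [NumberField K] [CharZero L] [FiniteDimensional K L] [IsGalois K L] in
/-- If `τ` fixes `r₀ = √d` then `(τσ) r₀ = r₀ ↔ σ r₀ = r₀`. [folklore] -/
theorem mul_apply_sqrt_eq_iff_of_apply_eq (τ σ : L ≃ₐ[K] L) {r₀ : L} {d : K} (hr : r₀ ^ 2 = algebraMap K L d)
    (hτ : τ r₀ = r₀) : (τ * σ) r₀ = r₀ ↔ σ r₀ = r₀ := by
  rw [AlgEquiv.mul_apply]
  rcases algEquiv_apply_sqrt_eq_or hr σ with h | h
  · rw [h, hτ]
  · rw [h, map_neg, hτ]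

end Membership

end Summit.BirchSwinnertonDyer.BirchSwinnertonDyer.Theorems.GoldfeldGoodTwists

end
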